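import Literature.NumberTheory.EllipticCurves.IwasawaSelmerControlCokerProofs
import Literature.NumberTheory.EllipticCurves.GreenbergSelmerDualDataExistsProofs
import Literature.NumberTheory.EllipticCurves.CyclotomicZpExtensionUnramifiedAwayPProofs
import Literature.NumberTheory.EllipticCurves.KellerYin2024.CharacterSelmerGroups
import Summits.BirchSwinnertonDyer.Rank1Residual.X11b.AnticyclotomicSelmer
import Summits.BirchSwinnertonDyer.BirchSwinnertonDyer.Theorems.SmallImageMuTransferMuTransferX9SelmerDualLocalFine
import HarnessLib

/-!
# Route `PrintCFram`, crux C2 `BottomClassIndexLawFiveLe` (stmt-BirchSwinnertonDyer-20372), line `eisenstein-resource-bdp-line`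
# (registry v5): TOWER DESCENT of the regularity hypothesis — a residual Selmer group vanishes over `K_∞` iff it
# vanishes over `K_n` (in particular over `K` itself)

Cell `bsd-print-cfram`, width seat `bsd-line-cfram-p1-w2` (generation g4); helper `--supports stmt-BirchSwinnertonDyer-20372`;
THEOREMS ONLY (0 definitions, 0 named facts, 0 instances, no `sorry`). HONEST FRAMING: nothing about BSD is proved here and no
stub of the line is closed. BSD is not proved by any of this; no summit statement is proved by this seat.

## Why

On the line of record the crux has been closed, on the REGULAR (Kriz–Li) LOCUS, modulo print and one value statement
(LEAD g5 `…RegularLocusCharTrivial`, w4 g0 `…EisensteinRegularLocusBSDp`): the input there is the regularity hypothesis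
AT THE TOP OF THE ANTICYCLOTOMIC TOWER,
`Nat.card (datumStrictSelmer κ.kerSubgroup Φ.Sub p (bdpData Φ.Sub p 𝔭) S) = 1` (and the same for `Φ.Quot`) — the two
residual Selmer groups `R_𝔭^S(K''_∞, Φ)`, `R_𝔭^S(K''_∞, W[p]/Φ)` of the residual line over `K''_∞`. This file proves, in
the tree's Greenberg–Vatsal formalism and for an ARBITRARY discrete `p`-primary `Γ_K`-module `M`, that such a vanishing
statement is EQUIVALENT to the same statement at any finite layer `K_n`, in particular at `K` (`κ.layerSubgroup 0 = ⊤`):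
there the residual Selmer group is a subgroup of `H¹(K, M)` cut out by finitely many local conditions — for `M = 𝔽_p(θ)` a
piece of a ray class group of `K(θ)` (Kriz–Li's «relative `p`-class numbers», FMS 2019 p. 3), certifiable per datum by a
class-group computation and, class-wide, one Gras-type citation away from the Bernoulli numbers of Kriz–Li Thm. 1.20 (4).

## What is proved

* §1 (algebra) `exists_mem_ne_zero_fixed_of_pow_sub_one_apply_eq_zero`: a non-zero vector on which `φ − 1` is nilpotent,
  inside a `φ`-stable subgroup, yields a non-zero `φ`-FIXED vector of that subgroup.
* §2 (generic; `K` a number field, `κ` ANY `ℤ_p`-extension with topological generator `γ`, `M` a discrete `p`-primary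
  `Γ_K`-module with continuous orbit maps, `L` Greenberg data above `p`, `S₀` any set of places):
  `exists_mem_ne_zero_conjH1_eq` — a non-zero conjugation-stable subgroup of `H¹(K_∞, M)` contains a non-zero class fixed
  by `conj_{γ^{pⁿ}}` (Greenberg LNM 1716 §1: `γ − 1` is locally nilpotent; tree `IwasawaDual.pow_mul_prime_pow_apply_eq_zero`);
  `resOfLe_comp_strictMap` / `resOfLe_mem_strictKer_of_mem_strictKer` / `mem_strictKer_of_resOfLe_mem_strictKer` — the strict
  local condition at `v ∣ p` goes DOWN along restriction always and UP when `M/M⁺_v` has no non-zero `ker κ ⊓ D_v`-fixed vector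
  (injectivity half of inflation–restriction, tree `resOfLe_injective_of_forall_fixed_eq_zero`);
  **`datumStrictSelmer_kerSubgroup_eq_bot_of_layer_eq_bot`** (DESCENT): `S^{S₀,str}_M(K_n) = 0 ⟹ S^{S₀,str}_M(K_∞) = 0`, via
  Greenberg's Lemma 3.2 = tree `ZpExtension.mem_range_resOfLe_of_conjH1_eq` (`cd_p ℤ_p = 1`) and `K_∞/K` unramified outside
  `p` off `S₀` (displayed hypothesis `I_v ≤ ker κ`; tree `resOfLe_mem_unramifiedOutside_iff`);
  **`datumStrictSelmer_layer_eq_bot_of_kerSubgroup_eq_bot`** (ASCENT) when `M^{ker κ} = 0`; the `iff`.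
* §3 (Castella's data `bdpData M p 𝔭`: strict at `𝔭`, relaxed at the other primes above `p` — both the Summits spelling
  `X11b.AcSelmer.bdpData` used by the regular-locus files and the definitionally equal Literature spelling
  `Castella2018.AcSelmer.bdpData` of CGLS Prop. 14): the fixed-vector clause IS the non-anomalous clause
  `M^{ker κ ⊓ D_𝔭} = 0` (`gr_fixed_bdpData`); **`residualSelmer_eq_bot_iff_layer`**:
  `R_𝔭^{S₀}(K_∞, M) = 0 ↔ R_𝔭^{S₀}(K_n, M) = 0` (unramifiedness of `K_∞/K` off `S₀ ∪ {p}` displayed as `I_v ≤ ker κ`;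
  it is the named fact `ZpExtension.inertia_le_kerSubgroup`, Washington Prop. 13.2, used in the companion file).
The instantiation on the CM-ramified class (both clauses for the isogeny line are LEAD g4's `IsogenyLineData`) and the
regular-locus theorems read with BOTTOM-LAYER regularity are the companion file `…RegularLocusBottomLayer`.

References: Greenberg, LNM 1716 (1999) §1, §3 Lemmas 3.1–3.2; Greenberg–Vatsal 2000 §2; Castella–Grossi–Lee–Skinner 2022
§1.2 Def. 10, Prop. 14 (arXiv:2008.02571); Kriz–Li 2019 p. 3, Thm. 1.20; Washington Prop. 13.2; Serre, *Galois Cohomology* I §2.6.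
-/

set_option autoImplicit false
-- the summit namespace `Summit.BirchSwinnertonDyer.BirchSwinnertonDyer` repeats the problem name by design (D-0017)
set_option linter.dupNamespace false

noncomputable section

open scoped Classical

namespace Summit.BirchSwinnertonDyer.BirchSwinnertonDyer.Theorems.PrintCFram.RegularLocusTowerDescent

open NumberField IsDedekindDomain Field
  Literature.NumberTheory.EllipticCurves Literature.NumberTheory.EllipticCurves.GreenbergSelmer
  Literature.NumberTheory.EllipticCurves.GreenbergVatsal2000
  Literature.NumberTheory.GaloisRepresentations

/-! ## §1 Algebra: a non-zero vector on which `φ − 1` is nilpotent yields a non-zero `φ`-fixed vector -/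

/-- If `φ` preserves an additive subgroup `B`, `x ∈ B` is non-zero and `(φ − 1)^n x = 0`, then `B` contains a
non-zero vector fixed by `φ` (the last non-zero term of the sequence `(φ − 1)^j x`). [folklore] -/
theorem exists_mem_ne_zero_fixed_of_pow_sub_one_apply_eq_zero {A : Type*} [AddCommGroup A]
    (φ : AddMonoid.End A) (B : AddSubgroup A) (hB : ∀ x ∈ B, φ x ∈ B) {n : ℕ} :
    ∀ {x : A}, x ∈ B → x ≠ 0 → ((φ - 1) ^ n) x = 0 → ∃ y ∈ B, y ≠ 0 ∧ φ y = y := by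
  induction n with
  | zero =>
    intro x _ hx0 hn
    rw [pow_zero, AddMonoid.End.one_apply] at hn
    exact absurd hn hx0
  | succ n ih =>
    intro x hx hx0 hn
    by_cases h : (φ - 1) x = 0
    · refine ⟨x, hx, hx0, ?_⟩
      rwa [IwasawaDual.End_sub_apply, AddMonoid.End.one_apply, sub_eq_zero] at h
    · have hmem : (φ - 1) x ∈ B := by
        rw [IwasawaDual.End_sub_apply, AddMonoid.End.one_apply]
        exact B.sub_mem (hB x hx) hx
      rw [pow_succ, AddMonoid.End.coe_mul, Function.comp_apply] at hn
      exact ih hmem h hn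

/-! ## §2 Generic Galois cohomology over a `ℤ_p`-extension -/

section Generic

variable {K : Type} [Field K] [NumberField K] {p : ℕ} [Fact p.Prime] (κ : ZpExtension K p)
  {M : Type} [AddCommGroup M] [DistribMulAction (absoluteGaloisGroup K) M] [TopologicalSpace M]
  [DiscreteTopology M]

omit [NumberField K] in
/-- Continuous orbit maps into a discrete module have open stabilisers. [folklore] -/
theorem isOpen_stabilizer_of_continuous_smul
    (hcont : ∀ m : M, Continuous fun g : absoluteGaloisGroup K ↦ g • m) (m : M) :
    IsOpen (MulAction.stabilizer (absoluteGaloisGroup K) m : Set (absoluteGaloisGroup K)) := by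
  have h : (MulAction.stabilizer (absoluteGaloisGroup K) m : Set (absoluteGaloisGroup K)) =
      (fun g : absoluteGaloisGroup K ↦ g • m) ⁻¹' {m} := by
    ext g
    simp [MulAction.mem_stabilizer_iff]
  rw [h]
  exact (hcont m).isOpen_preimage _ (isOpen_discrete _)

omit [NumberField K] in
/-- Powers of `conj_σ` on `H¹(H, M)`: an additive endomorphism `φ` agreeing with `conj_σ` has `φ^m = conj_{σ^m}`
(pointwise). [folklore] -/
theorem pow_apply_eq_conjH1_pow_apply (H : Subgroup (absoluteGaloisGroup K)) [H.Normal] (σ : absoluteGaloisGroup K)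
    (φ : AddMonoid.End (subgroupH1 H M)) (hφ : ∀ x, φ x = conjH1 H M σ x) (m : ℕ) (x : subgroupH1 H M) :
    (φ ^ m) x = conjH1 H M (σ ^ m) x := by
  induction m generalizing x with
  | zero =>
    rw [pow_zero, pow_zero, AddMonoid.End.one_apply, conjH1_one_holds H M, AddMonoidHom.id_apply]
  | succ m ih =>
    rw [pow_succ, AddMonoid.End.coe_mul, Function.comp_apply, hφ, ih, pow_succ, conjH1_mul_holds H M,
      AddMonoidHom.comp_apply]

omit [NumberField K] in
/-- A class fixed by `conj_σ` is fixed by `conj_{σ^m}`. [folklore] -/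
theorem conjH1_pow_eq_self_of_eq (H : Subgroup (absoluteGaloisGroup K)) [H.Normal]
    {σ : absoluteGaloisGroup K} {x : subgroupH1 H M} (hx : conjH1 H M σ x = x) (m : ℕ) :
    conjH1 H M (σ ^ m) x = x := by
  induction m with
  | zero => rw [pow_zero, conjH1_one_holds H M, AddMonoidHom.id_apply]
  | succ m ih => rw [pow_succ, conjH1_mul_holds H M, AddMonoidHom.comp_apply, hx, ih]

/-- **A non-zero conjugation-stable subgroup of `H¹(K_∞, M)` contains a non-zero class fixed by
`conj_{γ^{pⁿ}}`** (`M` discrete `p`-primary with continuous orbit maps, `γ` a topological generator):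
every class is killed by some `p^k` and fixed by some `conj_{γ^{p^a}}`, so `conj_{γ^{pⁿ}} − 1` is nilpotent on
it (`IwasawaDual.pow_mul_prime_pow_apply_eq_zero`), and §1 applies. Greenberg, LNM 1716 §1 ("every element
is killed by `Tⁿ` for some `n`"). [cite: GreenbergLNM1716, §1 (after Conj. 1.3)] -/
theorem exists_mem_ne_zero_conjH1_eq {γ : absoluteGaloisGroup K} (hγ : κ.IsTopGenerator γ)
    (hcont : ∀ m : M, Continuous fun g : absoluteGaloisGroup K ↦ g • m)
    (htor : ∀ m : M, ∃ k : ℕ, p ^ k • m = 0) (n : ℕ)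
    (B : AddSubgroup (subgroupH1 κ.kerSubgroup M))
    (hB : ∀ (τ : absoluteGaloisGroup K), ∀ x ∈ B, conjH1 κ.kerSubgroup M τ x ∈ B) (hne : B ≠ ⊥) :
    ∃ y ∈ B, y ≠ 0 ∧ conjH1 κ.kerSubgroup M (γ ^ p ^ n) y = y := by
  obtain ⟨x, hxB, hx0⟩ : ∃ x ∈ B, x ≠ (0 : subgroupH1 κ.kerSubgroup M) := by
    by_contra h
    push Not at h
    exact hne ((AddSubgroup.eq_bot_iff_forall _).mpr h)
  have hp : p.Prime := Fact.out
  -- `x` is killed by `p^k` and fixed by `conj_{γ^{p^a}}`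
  obtain ⟨k, hk⟩ := GreenbergSelmer.exists_pow_smul_subgroupH1_eq_zero κ M htor x
  obtain ⟨a, ha⟩ := GreenbergSelmer.exists_conjH1_pow_prime_pow_eq κ M
    (isOpen_stabilizer_of_continuous_smul hcont) hγ x
  -- hence fixed by `(conj_{γ^{pⁿ}})^{p^a} = conj_{(γ^{p^a})^{pⁿ}}`
  set φ : AddMonoid.End (subgroupH1 κ.kerSubgroup M) := conjH1 κ.kerSubgroup M (γ ^ p ^ n) with hφ
  have hfixφ : (φ ^ p ^ a) x = x := by
    rw [pow_apply_eq_conjH1_pow_apply (M := M) κ.kerSubgroup (γ ^ p ^ n) φ (fun _ ↦ rfl) (p ^ a) x, ← pow_mul,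
      mul_comm, pow_mul]
    exact conjH1_pow_eq_self_of_eq (M := M) κ.kerSubgroup ha (p ^ n)
  have hnil : ((φ - 1) ^ (k * p ^ a)) x = 0 :=
    IwasawaDual.pow_mul_prime_pow_apply_eq_zero hp φ a hfixφ hk
  exact exists_mem_ne_zero_fixed_of_pow_sub_one_apply_eq_zero φ B (hB (γ ^ p ^ n)) hxB hx0 hnil

/-! ### Local conditions above `p` along a restriction -/

/-- Restriction commutes with the strict local maps: for `H ≤ H'` and a local datum `N` at `v`,
`res_{H ⊓ D_v ≤ H' ⊓ D_v} ∘ strictMap_{H'} = strictMap_H ∘ res_{H ≤ H'}` (both are induced by the compatible pair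
`(H ⊓ D_v ↪ H', M ↠ M/M⁺_v)`). [cite: Greenberg1989, §1 p. 98] -/
theorem resOfLe_comp_strictMap {H H' : Subgroup (absoluteGaloisGroup K)} (hle : H ≤ H')
    {v : HeightOneSpectrum (𝓞 K)} (N : LocalDatum K M v)
    (hD : decompIn H v ≤ decompIn H' v) :
    (Literature.NumberTheory.EllipticCurves.resOfLe N.Gr hD).comp (N.strictMap H') =
      (N.strictMap H).comp (Literature.NumberTheory.EllipticCurves.resOfLe M hle) := by
  rw [LocalDatum.strictMap, LocalDatum.strictMap, Literature.NumberTheory.EllipticCurves.resOfLe,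
    Literature.NumberTheory.EllipticCurves.resOfLe, resH1Hom_comp, resH1Hom_comp]
  exact resH1Hom_congr (by ext; rfl) (by ext; rfl) _ _

/-- `H ⊓ D_v ≤ H' ⊓ D_v` inside `D_v` for `H ≤ H'`. [folklore] -/
theorem decompIn_mono {H H' : Subgroup (absoluteGaloisGroup K)} (hle : H ≤ H') (v : HeightOneSpectrum (𝓞 K)) :
    decompIn H v ≤ decompIn H' v :=
  fun x hx ↦ (mem_decompIn_iff H' v x).2 (hle ((mem_decompIn_iff H v x).1 hx))

/-- **Strict ⟹ strict under restriction** (the easy direction): if `x ∈ H¹(H', M)` satisfies the strict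
condition at `v` for the datum `N`, so does `res x ∈ H¹(H, M)`. [cite: Greenberg1989, §1 p. 98] -/
theorem resOfLe_mem_strictKer_of_mem_strictKer {H H' : Subgroup (absoluteGaloisGroup K)} (hle : H ≤ H')
    {v : HeightOneSpectrum (𝓞 K)} (N : LocalDatum K M v) {x : subgroupH1 H' M}
    (hx : x ∈ N.strictKer H') : Literature.NumberTheory.EllipticCurves.resOfLe M hle x ∈ N.strictKer H := by
  rw [LocalDatum.mem_strictKer_iff] at hx ⊢
  have h := congrArg (fun f ↦ f x) (resOfLe_comp_strictMap (M := M) hle N (decompIn_mono hle v))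
  simp only [AddMonoidHom.comp_apply] at h
  rw [← h, hx, map_zero]

/-- **Strict condition DESCENDS along a restriction** when `M/M⁺_v` has no non-zero vector fixed by
`H ⊓ D_v` (`H` normal in `Γ_K`): if `res x ∈ H¹(H, M)` satisfies the strict condition at `v`, so does
`x ∈ H¹(H', M)` — the restriction `H¹(H' ⊓ D_v, M/M⁺_v) → H¹(H ⊓ D_v, M/M⁺_v)` is injective
(inflation–restriction, `resOfLe_injective_of_forall_fixed_eq_zero`). [cite: GreenbergLNM1716, §3 Lemma 3.1 (PDF p. 86)] -/
theorem mem_strictKer_of_resOfLe_mem_strictKer {H H' : Subgroup (absoluteGaloisGroup K)} [H.Normal]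
    (hle : H ≤ H') {v : HeightOneSpectrum (𝓞 K)} (N : LocalDatum K M v)
    (hfix : ∀ m : N.Gr, (∀ g : ↥(decomp v), (g : absoluteGaloisGroup K) ∈ H → g • m = m) → m = 0)
    {x : subgroupH1 H' M}
    (hx : Literature.NumberTheory.EllipticCurves.resOfLe M hle x ∈ N.strictKer H) : x ∈ N.strictKer H' := by
  rw [LocalDatum.mem_strictKer_iff] at hx ⊢
  haveI := Summit.BirchSwinnertonDyer.BirchSwinnertonDyer.Rank1Residual.SelmerDual.decompIn_normal H v
  have hinj := resOfLe_injective_of_forall_fixed_eq_zero (G := ↥(decomp v)) (M := N.Gr)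
    (decompIn_mono hle v) (fun m hm ↦ hfix m fun g hg ↦ hm g ((mem_decompIn_iff H v g).2 hg))
  apply hinj
  have h := congrArg (fun f ↦ f x) (resOfLe_comp_strictMap (M := M) hle N (decompIn_mono hle v))
  simp only [AddMonoidHom.comp_apply] at h
  rw [map_zero, h, hx]

/-! ### The descent and the ascent -/

/-- Inertia groups away from `p` (off `S₀`) are the same for `ker κ` and `Gal(K̄/K_n)` once `I_v ≤ ker κ`
(`K_∞/K` unramified outside `p`). [cite: Washington1997, Prop. 13.2] -/
theorem inertiaIn_kerSubgroup_eq_layer (n : ℕ) {v : HeightOneSpectrum (𝓞 K)}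
    (hI : inertia v ≤ κ.kerSubgroup) :
    inertiaIn κ.kerSubgroup v = inertiaIn (κ.layerSubgroup n) v := by
  rw [inertiaIn, inertiaIn, inf_eq_right.mpr hI, inf_eq_right.mpr (hI.trans (κ.kerSubgroup_le_layerSubgroup n))]

/-- **TOWER DESCENT OF VANISHING.** Let `M` be a discrete `p`-primary `Γ_K`-module with continuous orbit maps,
`κ` a `ℤ_p`-extension unramified outside `p` off `S₀` (`I_v ≤ ker κ`), `γ` a topological generator, `L` Greenberg
data above `p` such that at every `v ∣ p` the quotient `M/M⁺_v` has no non-zero vector fixed by `ker κ ⊓ D_v`.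
If the strict datum Selmer group over the layer `K_n` vanishes, `S^{S₀,str}_M(K_n) = 0`, then so does the one
over `K_∞`: `S^{S₀,str}_M(K_∞) = 0`. Proof: a non-zero class over `K_∞` has a non-zero `conj_{γ^{pⁿ}}`-fixed
multiple in the (conjugation-stable) Selmer group; it descends to `H¹(K_n, M)` by Greenberg's Lemma 3.2
(`ZpExtension.mem_range_resOfLe_of_conjH1_eq`, `cd_p ℤ_p = 1`); its local conditions descend (unramified: same
inertia groups; strict: injectivity of the local restriction under the fixed-vector clause); so it lies in
`S^{S₀,str}_M(K_n) = 0`. [cite: GreenbergLNM1716, §3 Lemmas 3.1–3.2 (PDF p. 86)] [cite: GreenbergVatsal2000, §2 pp. 15–17, 20] -/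
theorem datumStrictSelmer_kerSubgroup_eq_bot_of_layer_eq_bot {γ : absoluteGaloisGroup K}
    (hγ : κ.IsTopGenerator γ) (hcont : ∀ m : M, Continuous fun g : absoluteGaloisGroup K ↦ g • m)
    (htor : ∀ m : M, ∃ k : ℕ, p ^ k • m = 0) (L : Data K M p) (S₀ : Set (HeightOneSpectrum (𝓞 K))) (n : ℕ)
    (hunr : ∀ v : HeightOneSpectrum (𝓞 K), v ∉ S₀ → ((p : ℕ) : 𝓞 K) ∉ v.asIdeal → inertia v ≤ κ.kerSubgroup)
    (hfix : ∀ (v : HeightOneSpectrum (𝓞 K)) (hv : ((p : ℕ) : 𝓞 K) ∈ v.asIdeal) (m : (L v hv).Gr),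
      (∀ g : ↥(decomp v), (g : absoluteGaloisGroup K) ∈ κ.kerSubgroup → g • m = m) → m = 0)
    (hbot : datumStrictSelmer (κ.layerSubgroup n) M p L S₀ = ⊥) :
    datumStrictSelmer κ.kerSubgroup M p L S₀ = ⊥ := by
  by_contra hne
  have hle : κ.kerSubgroup ≤ κ.layerSubgroup n := κ.kerSubgroup_le_layerSubgroup n
  obtain ⟨y, hy, hy0, hyfix⟩ := exists_mem_ne_zero_conjH1_eq κ hγ hcont htor n
    (datumStrictSelmer κ.kerSubgroup M p L S₀)
    (fun τ x hx ↦ KellerYin2024.conjH1_mem_datumStrictSelmer M S₀ κ.kerSubgroup L τ hx) hne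
  obtain ⟨c, hc⟩ := AddMonoidHom.mem_range.mp
    (ZpExtension.mem_range_resOfLe_of_conjH1_eq κ hγ n hcont htor y hyfix)
  have hy' := hy
  rw [mem_datumStrictSelmer_iff] at hy'
  have hcSel : c ∈ datumStrictSelmer (κ.layerSubgroup n) M p L S₀ := by
    rw [mem_datumStrictSelmer_iff]
    refine ⟨?_, fun v hv σ ↦ ?_⟩
    · have h1 := hy'.1
      rw [← hc] at h1
      exact (resOfLe_mem_unramifiedOutside_iff hle p S₀
        (fun v hv hpv ↦ inertiaIn_kerSubgroup_eq_layer κ n (hunr v hv hpv)) c).mp h1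
    · apply mem_strictKer_of_resOfLe_mem_strictKer hle (L v hv) (hfix v hv)
      have hcomm : Literature.NumberTheory.EllipticCurves.resOfLe M hle (conjH1 (κ.layerSubgroup n) M σ c) =
          conjH1 κ.kerSubgroup M σ (Literature.NumberTheory.EllipticCurves.resOfLe M hle c) :=
        congrArg (fun f ↦ f c) (resOfLe_comp_conjH1_holds (M := M) hle σ)
      rw [hcomm, hc]
      exact hy'.2 v hv σ
  rw [hbot, AddSubgroup.mem_bot] at hcSel
  rw [hcSel, map_zero] at hc
  exact hy0 hc.symm

/-- **ASCENT (the converse).** If `M` has no non-zero `ker κ`-fixed vector, restriction `H¹(K_n, M) → H¹(K_∞, M)`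
is injective (`resOfLe_injective_of_forall_fixed_eq_zero`) and carries `S^{S₀,str}_M(K_n)` into `S^{S₀,str}_M(K_∞)`;
so `S^{S₀,str}_M(K_∞) = 0` forces `S^{S₀,str}_M(K_n) = 0`. [cite: GreenbergLNM1716, §3 Lemma 3.1 (PDF p. 86)]
[cite: GreenbergVatsal2000, §2 pp. 15–17, 20] -/
theorem datumStrictSelmer_layer_eq_bot_of_kerSubgroup_eq_bot (L : Data K M p)
    (S₀ : Set (HeightOneSpectrum (𝓞 K))) (n : ℕ)
    (hunr : ∀ v : HeightOneSpectrum (𝓞 K), v ∉ S₀ → ((p : ℕ) : 𝓞 K) ∉ v.asIdeal → inertia v ≤ κ.kerSubgroup)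
    (hM : ∀ m : M, (∀ g ∈ κ.kerSubgroup, g • m = m) → m = 0)
    (htop : datumStrictSelmer κ.kerSubgroup M p L S₀ = ⊥) :
    datumStrictSelmer (κ.layerSubgroup n) M p L S₀ = ⊥ := by
  have hle : κ.kerSubgroup ≤ κ.layerSubgroup n := κ.kerSubgroup_le_layerSubgroup n
  rw [eq_bot_iff]
  intro c hc
  rw [AddSubgroup.mem_bot]
  have hres : Literature.NumberTheory.EllipticCurves.resOfLe M hle c ∈ datumStrictSelmer κ.kerSubgroup M p L S₀ := by
    rw [mem_datumStrictSelmer_iff] at hc ⊢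
    refine ⟨(resOfLe_mem_unramifiedOutside_iff hle p S₀
        (fun v hv hpv ↦ inertiaIn_kerSubgroup_eq_layer κ n (hunr v hv hpv)) c).mpr hc.1, fun v hv σ ↦ ?_⟩
    have hcomm : conjH1 κ.kerSubgroup M σ (Literature.NumberTheory.EllipticCurves.resOfLe M hle c) =
        Literature.NumberTheory.EllipticCurves.resOfLe M hle (conjH1 (κ.layerSubgroup n) M σ c) :=
      (congrArg (fun f ↦ f c) (resOfLe_comp_conjH1_holds (M := M) hle σ)).symm
    rw [hcomm]
    exact resOfLe_mem_strictKer_of_mem_strictKer hle (L v hv) (hc.2 v hv σ)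
  rw [htop, AddSubgroup.mem_bot] at hres
  exact resOfLe_injective_of_forall_fixed_eq_zero hle hM (by rw [hres, map_zero])

/-- **The vanishing of the strict datum Selmer group is the same at every layer and at the top** (under the
fixed-vector clauses): `S^{S₀,str}_M(K_∞) = 0 ↔ S^{S₀,str}_M(K_n) = 0`. [cite: GreenbergLNM1716, §3 Lemmas 3.1–3.2 (PDF p. 86)] -/
theorem datumStrictSelmer_kerSubgroup_eq_bot_iff_layer {γ : absoluteGaloisGroup K}
    (hγ : κ.IsTopGenerator γ) (hcont : ∀ m : M, Continuous fun g : absoluteGaloisGroup K ↦ g • m)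
    (htor : ∀ m : M, ∃ k : ℕ, p ^ k • m = 0) (L : Data K M p) (S₀ : Set (HeightOneSpectrum (𝓞 K))) (n : ℕ)
    (hunr : ∀ v : HeightOneSpectrum (𝓞 K), v ∉ S₀ → ((p : ℕ) : 𝓞 K) ∉ v.asIdeal → inertia v ≤ κ.kerSubgroup)
    (hfix : ∀ (v : HeightOneSpectrum (𝓞 K)) (hv : ((p : ℕ) : 𝓞 K) ∈ v.asIdeal) (m : (L v hv).Gr),
      (∀ g : ↥(decomp v), (g : absoluteGaloisGroup K) ∈ κ.kerSubgroup → g • m = m) → m = 0)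
    (hM : ∀ m : M, (∀ g ∈ κ.kerSubgroup, g • m = m) → m = 0) :
    datumStrictSelmer κ.kerSubgroup M p L S₀ = ⊥ ↔ datumStrictSelmer (κ.layerSubgroup n) M p L S₀ = ⊥ :=
  ⟨datumStrictSelmer_layer_eq_bot_of_kerSubgroup_eq_bot κ L S₀ n hunr hM,
    datumStrictSelmer_kerSubgroup_eq_bot_of_layer_eq_bot κ hγ hcont htor L S₀ n hunr hfix⟩

end Generic

/-! ## §3 Castella's data (strict at `𝔭`, relaxed at the other primes above `p`): the fixed-vector clause is
the non-anomalous clause `M^{ker κ ⊓ D_𝔭} = 0` -/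

section BDP

variable {K : Type} [Field K] [NumberField K] {p : ℕ} [Fact p.Prime] (κ : ZpExtension K p)
  {M : Type} [AddCommGroup M] [DistribMulAction (absoluteGaloisGroup K) M] [TopologicalSpace M]
  [DiscreteTopology M]

omit [TopologicalSpace M] [DiscreteTopology M] in
/-- For the STRICT datum `M⁺_v = 0` the graded piece is `M/0`, so "no non-zero `H ⊓ D_v`-fixed vector in `M/M⁺_v`"
is "no non-zero `H ⊓ D_v`-fixed vector in `M`". [cite: Castella2018, §2.1 Def. 2.1–2.2 (arXiv:1704.06608 p. 5)] -/
theorem gr_fixed_strictDatum (H : Subgroup (absoluteGaloisGroup K)) (v : HeightOneSpectrum (𝓞 K))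
    (hM : ∀ m : M, (∀ g ∈ H ⊓ decomp v, g • m = m) → m = 0)
    (m : (Summit.BirchSwinnertonDyer.Rank1Residual.X11b.AcSelmer.strictDatum M v).Gr)
    (hm : ∀ g : ↥(decomp v), (g : absoluteGaloisGroup K) ∈ H → g • m = m) : m = 0 := by
  obtain ⟨m₀, rfl⟩ := (Summit.BirchSwinnertonDyer.Rank1Residual.X11b.AcSelmer.strictDatum M v).grMk_surjective m
  have h0 : m₀ = 0 := hM m₀ fun g hg ↦ by
    obtain ⟨hgH, hgD⟩ := Subgroup.mem_inf.mp hg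
    have h := hm ⟨g, hgD⟩ hgH
    rw [LocalDatum.smul_grMk] at h
    have hker : g • m₀ - m₀ ∈
        (Summit.BirchSwinnertonDyer.Rank1Residual.X11b.AcSelmer.strictDatum M v).grMk.ker := by
      rw [AddMonoidHom.mem_ker, map_sub, sub_eq_zero]
      exact h
    rw [LocalDatum.ker_grMk] at hker
    change g • m₀ - m₀ ∈ (⊥ : AddSubgroup M) at hker
    exact sub_eq_zero.mp ((AddSubgroup.mem_bot).mp hker)
  rw [h0, map_zero]

omit [TopologicalSpace M] [DiscreteTopology M] in
/-- For the RELAXED datum `M⁺_v = M` the graded piece `M/M` is trivial. [cite: Castella2018, §2.1 (arXiv:1704.06608 p. 5)] -/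
theorem gr_fixed_relaxedDatum (v : HeightOneSpectrum (𝓞 K))
    (m : (Summit.BirchSwinnertonDyer.Rank1Residual.X11b.AcSelmer.relaxedDatum M v).Gr) : m = 0 := by
  haveI : Subsingleton (Summit.BirchSwinnertonDyer.Rank1Residual.X11b.AcSelmer.relaxedDatum M v).Gr :=
    (QuotientAddGroup.subsingleton_quotient_top : Subsingleton (M ⧸ (⊤ : AddSubgroup M)))
  exact Subsingleton.elim _ _

omit [TopologicalSpace M] [DiscreteTopology M] in
/-- **The fixed-vector clause for Castella's data `bdpData M p 𝔭`** (strict at `𝔭`, relaxed at the other primes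
above `p`; the tree's `X11b.AcSelmer.bdpData`, definitionally the Literature `Castella2018.AcSelmer.bdpData`) IS the
non-anomalous clause at the strict prime: `M` has no non-zero vector fixed by `ker κ ⊓ D_𝔭`.
[cite: Castella2018, Def. 2.2 (arXiv:1704.06608 p. 5)] -/
theorem gr_fixed_bdpData (𝔭 : HeightOneSpectrum (𝓞 K))
    (hM𝔭 : ∀ m : M, (∀ g ∈ κ.kerSubgroup ⊓ decomp 𝔭, g • m = m) → m = 0) :
    ∀ (v : HeightOneSpectrum (𝓞 K)) (hv : ((p : ℕ) : 𝓞 K) ∈ v.asIdeal)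
      (m : (Summit.BirchSwinnertonDyer.Rank1Residual.X11b.AcSelmer.bdpData M p 𝔭 v hv).Gr),
      (∀ g : ↥(decomp v), (g : absoluteGaloisGroup K) ∈ κ.kerSubgroup → g • m = m) → m = 0 := by
  intro v hv
  by_cases hv𝔭 : v = 𝔭
  · subst hv𝔭
    rw [Summit.BirchSwinnertonDyer.Rank1Residual.X11b.AcSelmer.bdpData_self]
    exact fun m hm ↦ gr_fixed_strictDatum κ.kerSubgroup v hM𝔭 m hm
  · rw [Summit.BirchSwinnertonDyer.Rank1Residual.X11b.AcSelmer.bdpData_of_ne p 𝔭 hv hv𝔭]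
    exact fun m _ ↦ gr_fixed_relaxedDatum v m

/-- **TOWER DESCENT for Castella's residual Selmer groups `R_𝔭^{S₀}(·, M)`** (strict at `𝔭`, relaxed at the other
primes above `p`, unramified off `S₀ ∪ {v ∣ p}`, no condition at `S₀`): for `M` discrete `p`-primary with continuous
orbit maps and NO non-zero `ker κ ⊓ D_𝔭`-fixed vector, `κ` unramified outside `p` off `S₀`, `γ` a topological
generator and any layer `n`:
`R_𝔭^{S₀}(K_∞, M) = 0 ↔ R_𝔭^{S₀}(K_n, M) = 0` (tree: `datumStrictSelmer (ker κ) … = ⊥ ↔ datumStrictSelmer (Gal(K̄/K_n)) … = ⊥`).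
For `n = 0` (`κ.layerSubgroup 0 = ⊤`, `ZpExtension.layerSubgroup_zero`) the right side is the residual Selmer group over
`K` itself — a subgroup of the finite group `H¹(K_Σ/K, M)`. [cite: GreenbergLNM1716, §3 Lemmas 3.1–3.2 (PDF p. 86)]
[cite: CastellaGrossiLeeSkinner2022, §1.2 Def. 10 (arXiv:2008.02571)] -/
theorem residualSelmer_eq_bot_iff_layer {γ : absoluteGaloisGroup K} (hγ : κ.IsTopGenerator γ)
    (hcont : ∀ m : M, Continuous fun g : absoluteGaloisGroup K ↦ g • m)
    (htor : ∀ m : M, ∃ k : ℕ, p ^ k • m = 0) (𝔭 : HeightOneSpectrum (𝓞 K))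
    (S₀ : Set (HeightOneSpectrum (𝓞 K))) (n : ℕ)
    (hunr : ∀ v : HeightOneSpectrum (𝓞 K), v ∉ S₀ → ((p : ℕ) : 𝓞 K) ∉ v.asIdeal → inertia v ≤ κ.kerSubgroup)
    (hM𝔭 : ∀ m : M, (∀ g ∈ κ.kerSubgroup ⊓ decomp 𝔭, g • m = m) → m = 0) :
    datumStrictSelmer κ.kerSubgroup M p (Summit.BirchSwinnertonDyer.Rank1Residual.X11b.AcSelmer.bdpData M p 𝔭) S₀ = ⊥ ↔
      datumStrictSelmer (κ.layerSubgroup n) M p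
        (Summit.BirchSwinnertonDyer.Rank1Residual.X11b.AcSelmer.bdpData M p 𝔭) S₀ = ⊥ :=
  datumStrictSelmer_kerSubgroup_eq_bot_iff_layer κ hγ hcont htor _ S₀ n hunr (gr_fixed_bdpData κ 𝔭 hM𝔭)
    fun m hm ↦ hM𝔭 m fun g hg ↦ hm g (Subgroup.mem_inf.mp hg).1

end BDP

end Summit.BirchSwinnertonDyer.BirchSwinnertonDyer.Theorems.PrintCFram.RegularLocusTowerDescent

end
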